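import Literature.NumberTheory.Automorphic.ConjugateSymplecticLocalComponentSurjective          -- ★ p834791 (this seat): GLOB `IdeleClassGroup.exists_isConjugateSymplectic_semilocalComponent_eq`
import Literature.NumberTheory.Automorphic.CMXiTorusCharReparametrisation                     -- ★ p835601 (B-p04 (g32)): `UnitaryGroup.keysCaseTwoReducible_of_thetaShape` (reparametrisation brick)
import Summits.HodgeConjecture.HodgeConjecture.Theorems.F0P2oCmPrincipalSeriesReducibleOfThetaType  -- ★ (B-p10 (g22), (1b)): `exists_subrepresentation_ne_bot_ne_top_of_N3` (local core: K1 chain ★ + N1 ★ + (1a) ★ p835386)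
import Summits.HodgeConjecture.HodgeConjecture.Theorems.F0P2oThetaCenterCharGlobalise          -- ★ p829029: `exists_chi_isThetaCenterChar`
import HarnessLib

/-!
# Crux `H413`, T3b node N4 — #106 `Rogawski1990.KeysCaseTwoReducible` FROM #96 N3 (the theta road named by the letter's own docstring)

Cell hodgecm-mathlib (D-0151), FLOOR 0, crux H413 = stmt-HodgeConjecture-24833; T3b line `Cruxes/H413/Lines/F0_P3_KeysCaseTwoPaydown.lean` ED. 5 (F0P3b-plan pen;
sorries `{N4}`), closer ED. 11b `stub_N4`: the N4 letter ★ `Rogawski1990.KeysCaseTwoReducible L` ([Keys1984 §7 Thm (2)]; booked #106 «LETTER, XL — intertwining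
operators ∕ `c`-functions not typed») is, after ★ p835351 `keysCaseTwo_of_N4` and ★ p834912 (N5), the LAST letter below NF1 `KeysCaseTwo`.  The letter's docstring
names a second in-house road: «the Weil-representation realisation of `πⁿ(ξ)` as a constituent with one-dimensional Jacquet module [GelbartRogawski1991 §5]».
THIS FILE closes that road modulo the ONE print letter N3 = #96 ★ `GelbartRogawski1991.thetaType_nonsplit_jacquetModule` (already booked on the K1 ∕ T7 ∕ PKΠ
lines).  Seat B-p14 (g28): census + GLOB (★ p834574 ∕ p834791); F0P2-plan (g8) «=» 20:42:59Z; F0P3b-plan (g10) GO 21:16:35Z; local core ★ B-p10 (g22); reparametrisation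
brick ★ B-p04 (g32).

HEAD: `keysCaseTwoReducible_of_N3 (hN3 : thetaType_nonsplit_jacquetModule) (L) : KeysCaseTwoReducible L` — the #106 letter BY NAME from the #96 letter BY NAME.

THE PROOF (every other input ★).  By ★ `UnitaryGroup.keysCaseTwoReducible_of_thetaShape` (reparametrisation `(μ′, η₁, η₂) ↦ (μ′·(η₁η₂)∘quotConj, η₂⁻¹, η₂)`) it
suffices to show, at every non-split `v`, for every continuous LOCAL `μ′` of `ω`-type and every continuous `ψ`, that `i_G(cmXiTorusChar L v μ′ ψ⁻¹ ψ)` has a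
subrepresentation `≠ ⊥, ⊤` (`cmPrincipalSeries_thetaShape_reducible_of_N3`).  GLOBALISE: ★ p834791 gives a conjugate-symplectic `μ : C_L → S¹` with
`(toHeckeCharacter L μ)_v = μ′` ([ClozelHarrisTaylor2008 Lem. 4.1.1] + Hilbert 90 + finite-abelian duality); ★ `exists_chi_isThetaCenterChar` makes `ψ` the theta
centre character of some continuous unitary `χ_f` at EVERY line `ε`; the LOCAL CORE ★ `exists_subrepresentation_ne_bot_ne_top_of_N3` (N3 ⇒ `dim r_N(X_v) ≤ 1`, U1 ⟸ N3,
the K1 chain `X_v ∈ JH(i_G(χθ))`, and ★ N1 `dim r_N(i_G(χθ)) = 2`) then says `i_G(χθ)` is reducible, `χθ = cmXiTorusChar L v μ_v ψ⁻¹ ψ`; `subst μ_v = μ′`.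
No definition, no named fact, no instance, no notation, no `sorry`; kernel lane `--supports stmt-HodgeConjecture-24833`.
HONEST LABEL: HC_CM is proved only modulo the 2 remaining named inputs (hLiu418, h413) until rung 0 closes; this file is CONDITIONAL on N3 (#96) and proves
#106 from it — books: #106 CLOSED-derived from #96 at the folds `stub_N4 := fun L _ _ _ => keysCaseTwoReducible_of_N3 ‹N3 letter› L` (closer ED. 11b) ∕
`stub_keysCaseTwoReducible := keysCaseTwoReducible_of_N3 ‹N3 letter› L` (T3b ED. 6).

## References
* [Keys1984] D. Keys, Compositio Math. 51 (1984), §7 Thm. (2) p. 126.  [Rogawski1990] Ann. of Math. Stud. 123, §4.8 p. 51, §12.2 (2) pp. 173–174.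
* [GelbartRogawski1991] Invent. Math. 105 (1991): §3.2 (3.2.1)–(3.2.3) p. 457; §5.1 (5.1.1), Lem. 5.1.2 pp. 465–466.  [Kudla1986] Invent. Math. 83: Thm. 2.8.
* [Casselman1995] Lemma 7.1.1 (a) p. 67; Thm. 6.6.2 p. 66.  [ClozelHarrisTaylor2008] Lemma 4.1.1 (p. 116).
-/

set_option autoImplicit false
-- the mandated namespace has the single-problem summit's repeated segment (`HodgeConjecture.HodgeConjecture`)
set_option linter.dupNamespace false

noncomputable section

open NumberField IsDedekindDomain MeasureTheory
open scoped Matrix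

open Literature.NumberTheory Literature.NumberTheory.Automorphic Literature.NumberTheory.Automorphic.UnitaryGroup
open Literature.NumberTheory.Automorphic.IdeleClassGroup
open Literature.NumberTheory.GaloisRepresentations
open Literature.NumberTheory.Rogawski1990
open Literature.NumberTheory.GelbartRogawski1991

namespace Summit.HodgeConjecture.HodgeConjecture.Cruxes.H413.F0P3KeysCaseTwoReducibleOfN3

variable (L : Type) [Field L] [NumberField L] [IsCMField L]

/-! ## §1 The theta shape at ARBITRARY local data, from N3 -/

set_option synthInstance.maxHeartbeats 400000 in
set_option maxHeartbeats 4000000 in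
/-- **Reducibility of `i_G(μ′‖·‖^{1/2} ⊗ ψ)` for EVERY local `ω`-type `μ′`** (non-split `v`; `μ′`, `ψ` continuous): `i_G(cmXiTorusChar L v μ′ ψ⁻¹ ψ)` has a
subrepresentation `≠ ⊥, ⊤`.  GLOBALISE `μ′` (★ p834791 `exists_isConjugateSymplectic_semilocalComponent_eq`) and `ψ` (★ `exists_chi_isThetaCenterChar`), then the
LOCAL CORE ★ `F0P2oCmPrincipalSeriesReducibleOfThetaType.exists_subrepresentation_ne_bot_ne_top_of_N3` at `(μ, χ_f, ψ)`, and `subst` the local component.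
[cite: Rogawski1990, §4.8 p. 51; §12.2 (2) pp. 173–174] [cite: GelbartRogawski1991, §3.2 (3.2.1)–(3.2.2) p. 457; §5.1 Lem. 5.1.2 pp. 465–466]
[cite: ClozelHarrisTaylor2008, Lemma 4.1.1 (p. 116)] -/
theorem cmPrincipalSeries_thetaShape_reducible_of_N3 (hN3 : Literature.NumberTheory.GelbartRogawski1991.thetaType_nonsplit_jacquetModule)
    (v : HeightOneSpectrum (𝓞 ↥(maximalRealSubfield L))) (hns : ∀ w : PlacesOver L v, IsCMField.complexConj L • w.1 = w.1)
    (μ' : (LocalRing L v)ˣ →* ℂˣ) (ψ : ↥(normOneUnits (conjLocal L (IsCMField.complexConj L) v)) →* ℂˣ)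
    (hμ'q : IsQuadraticCharExtension (conjLocal L (IsCMField.complexConj L) v) μ')
    (hμ'c : Continuous fun x => ((μ' x : ℂˣ) : ℂ)) (hψc : Continuous fun x => ((ψ x : ℂˣ) : ℂ)) :
    ∃ N : Subrepresentation (cmPrincipalSeries L 3 v (cmXiTorusChar L v μ' ψ⁻¹ ψ)), N ≠ ⊥ ∧ N ≠ ⊤ := by
  -- ★ GLOB: a conjugate-symplectic `μ` with `μ_v = μ′`
  obtain ⟨μ, hμ, hμv⟩ := IdeleClassGroup.exists_isConjugateSymplectic_semilocalComponent_eq L v hns μ' hμ'q hμ'c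
  subst hμv
  -- ★ the centre character `ψ` is `χ_{f,v} μ_v⁻¹` for some continuous unitary `χ_f`, at every line
  obtain ⟨χf, hχc, hχu, hcen⟩ := F0P2oThetaCenterCharGlobalise.exists_chi_isThetaCenterChar L μ hμ v hns ψ hψc
  -- ★ the local core (N3 ⇒ K1 chain + `dim r_N(X_v) ≤ 1` vs ★ N1 `dim r_N(i_G(χθ)) = 2`)
  exact F0P2oCmPrincipalSeriesReducibleOfThetaType.exists_subrepresentation_ne_bot_ne_top_of_N3 hN3 L μ hμ χf hχc hχu v hns ψ hcen

/-! ## §2 The head: N4 (#106) from N3 (#96) -/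

/-- **#106 ⟸ #96: Keys' case (2) reducibility of `i_G(χ_ξ)` FROM the Jacquet module of the local theta type.**  Hypothesis: the print letter ★
`GelbartRogawski1991.thetaType_nonsplit_jacquetModule` BY NAME ([GelbartRogawski1991 §3.2 (3.2.1)–(3.2.3) p. 457; Kudla1986 Thm. 2.8]).  Conclusion: the print letter ★
`Rogawski1990.KeysCaseTwoReducible L` BY NAME ([Keys1984 §7 Thm. (2)]; [Rogawski1990 §12.2 (2)]): at every non-split `v`, for every continuous `μ′` extending `ω_v` and
all continuous `η₁, η₂`, `i_G(χ_ξ)` has a subrepresentation `≠ ⊥, ⊤` — by ★ B-p04's reparametrisation `keysCaseTwoReducible_of_thetaShape` from §1.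
[cite: Keys1984, §7 Theorem (2) p. 126] [cite: Rogawski1990, §12.2 (2) pp. 173–174] [cite: GelbartRogawski1991, §5.1 Lem. 5.1.2 pp. 465–466] [cite: Casselman1995, Lemma 7.1.1 (a) p. 67] -/
theorem keysCaseTwoReducible_of_N3 (hN3 : Literature.NumberTheory.GelbartRogawski1991.thetaType_nonsplit_jacquetModule) :
    Literature.NumberTheory.Rogawski1990.KeysCaseTwoReducible L :=
  UnitaryGroup.keysCaseTwoReducible_of_thetaShape L fun v hns μ' ψ hμ'q hμ'c hψc =>
    cmPrincipalSeries_thetaShape_reducible_of_N3 L hN3 v hns μ' ψ hμ'q hμ'c hψc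

/-- **The closed form** `∀ L, KeysCaseTwoReducible L` from the closed form of N3 — the exact shape of the closer's `stub_N4` binder (K9β ED. 11b) and of the
T3b line's `stub_keysCaseTwoReducible` after `fun L _ _ _ =>`. [cite: Keys1984, §7 Theorem (2) p. 126] [cite: Rogawski1990, §12.2 (2) pp. 173–174] -/
theorem keysCaseTwoReducible_closed_of_N3 (hN3 : Literature.NumberTheory.GelbartRogawski1991.thetaType_nonsplit_jacquetModule) :
    ∀ (L : Type) [Field L] [NumberField L] [IsCMField L], Literature.NumberTheory.Rogawski1990.KeysCaseTwoReducible L :=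
  fun L _ _ _ => keysCaseTwoReducible_of_N3 L hN3

end Summit.HodgeConjecture.HodgeConjecture.Cruxes.H413.F0P3KeysCaseTwoReducibleOfN3

end
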